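import Summits.BirchSwinnertonDyer.Rank1Residual.X1.GeneratorCountLayerTransport
import Summits.BirchSwinnertonDyer.Rank1Residual.X1.GeneratorCountTorsion
import HarnessLib

/-!
# Route M's generator COUNT at LAYER `n`, III: the LOSSY count over `K_n` at members with rational
# `p`-torsion — `#s ≤ #(X/(p, ω_n)X) · #ker h'_0` (cell `b2b-bsdres`, unit `b2b-bsdres-eisenstein-p1`,
# gen 17; X1R0-GAPMAP §25.2 V80 at layer `n`, §26.4)

HONEST FRAMING (run/shared/lean/b2b/bsd-rank1-residual/, verbatim in every file): the goal of the
cell is to DELETE the COMBINATION-SHAPED residual classes of the Birch–Swinnerton-Dyer formula for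
ALL analytic-rank `≤ 1` elliptic curves over `ℚ` — "full BSD formula for every rank `≤ 1` curve in
class `C`" assembled STRICTLY from published theorems — so that the rank-`≤ 1` remainder becomes
exactly the CONSTRUCTION-SHAPED classes, which are TYPED (missing-input `Prop`s), NOT attempted.
This is not "finishing BSD". Sub-cell `b2b-bsdres-eisenstein-p1` (CLASS-OWNERS row "X1 (r = 0)"):
research route; NO CLAIM BEYOND STATED CLASSES; nothing here changes a label; nothing is booked.
THEOREMS ONLY — no definition, no named fact, no typed input introduced, nothing about any
particular curve asserted.

## What and why

FILE 6 (`X1/GeneratorCountLayerTransport`) counts level-`0` classes over the layer `K_n` (restricted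
tower `κ_n`, transport `kerH1Iso`) by `X/(p, ω_n)X` when `E(K)[p] = 0` (`h'_0` injective). At the
members WITH rational `p`-torsion (`δ = 1`, 311 of the 482 route-M₀ closing members of the census)
`h'_0 : H¹(K_n, E[p^∞]) → H¹(K_{n,∞}, E[p^∞])` is not injective; as at layer `0`
(`X1/GeneratorCountTorsion.lean`, gen 16 V80) the count survives LOSSILY:

* `card_le_natCard_quotient_layerIdeal_mul_natCard_ker_of_restrictTower` (K-general): for ANY
  elliptic curve over a number field `K`, `ℤ_p`-extension `κ`, layer `n` with restricted tower `κ_n`,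
  `γ ∈ Γ_K` and dual datum `D` with `X = D.X` finitely generated, and `ker h'_0` finite: a finite
  family `s` of distinct `p`-torsion classes of `A'_0 = h'_0⁻¹(Sel_{p^∞}(E_{K_n}/K_{n,∞}))` has
  **`#s ≤ #(X/I_n X) · #ker h'_0`**, `I_n = (p, (1+T)^{pⁿ} − 1)` — the fibres of
  `kerH1Iso ∘ h'_0` embed in `ker h'_0`, the images are `p`-torsion and `γ^{pⁿ}`-fixed (FILE 6
  `conjH1_kerH1Iso_layerToInfty_eq`), FILE 4's pairing counts them.
* `…_mul_natCard_fixedPoints_…`: `#ker h'_0 = #E[p^∞]^{Γ_{K_n}}` (`= #E(K_n)[p^∞]`, gen 16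
  `GeneratorCountTorsion.natCard_ker_layerToInfty_zero_eq` over `K_n`, Greenberg Lemma 3.1) when
  `E(K_{n,∞})[p^∞]` is finite; with FILE 5: **`#s ≤ p^{λ + pⁿμ} · #E[p^∞]^{Γ_{K_n}}`**.

For `ℚ`, `p` odd good ordinary, `κ` cyclotomic: `E(ℚ_∞)[p^∞] = E(ℚ)[p^∞]` (tree
`natCard_fixedPoints_kerSubgroup_eq_of_ordinary`), so the loss at every layer is the rational one,
`≤ p^{2 v_p(#E(ℚ)_tors)}` in the count — the layer-`n` form of X1R0-GAPMAP §14.1's `−2δ`. NOT here: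
the local term `a` at the prime above `p` (which at `δ = 1` members restores the `2δ`). Nothing is
booked by this file.

References: [GreenbergLNM1716] §3 Lemma 3.1 (p. 86), §4 Lemma 4.3, §5 pp. 114–118, p. 137;
[SerreGaloisCohomology1997] I.§2.4; X1R0-GAPMAP §14.1, §25.2, §26.
-/

noncomputable section

open scoped Classical

open Function Field NumberField IsDedekindDomain WeierstrassCurve PowerSeries
  Literature.NumberTheory.EllipticCurves Literature.NumberTheory.GaloisRepresentations
  Literature.NumberTheory.GaloisCohomology
  Literature.NumberTheory.EllipticCurves.IwasawaAlgebra IsLocalRing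
  Summit.BirchSwinnertonDyer.Rank1Residual.Additive
  Summit.BirchSwinnertonDyer.Rank1Residual.Additive.ZpTower
  Summit.BirchSwinnertonDyer.Rank1Residual.X1.GeneratorCountLayer
  Summit.BirchSwinnertonDyer.Rank1Residual.X1.GeneratorBoundMuLayer
  Summit.BirchSwinnertonDyer.Rank1Residual.X1.GeneratorCountLayerTransport

set_option autoImplicit false

namespace Summit.BirchSwinnertonDyer.Rank1Residual.X1.GeneratorCountLayerTransportTorsion

variable {K : Type} [Field K] [NumberField K] {p : ℕ} [hp : Fact p.Prime]
variable {W : WeierstrassCurve K} {κ : ZpExtension K p} (n : ℕ) (κn : ZpExtension (κ.layer n) p)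
  (hκn : ∀ σ : Field.absoluteGaloisGroup (κ.layer n),
    (κn σ).toAdd * (p : ℤ_[p]) ^ n = (κ (resGal (K := K) (κ.layer n) σ)).toAdd)
  {γ : Field.absoluteGaloisGroup K} (D : W.SelmerDualData κ γ)

include hκn

/-- **The lossy count over `K_n`: `#s ≤ #(X/I_n X) · #ker h'_0`** for a finite family `s` of
distinct `p`-torsion classes of `A'_0 ⊆ H¹(K_n, E[p^∞])` (restricted tower `κ_n`), any dual datum `D`
of `Sel_{p^∞}(E/K_∞)` over `(κ, γ)` with `X` finitely generated, `ker h'_0` finite: the fibres of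
`kerH1Iso ∘ h'_0` embed in `ker h'_0` (`kerH1Iso` injective), the images are `p`-torsion and fixed by
`γ^{pⁿ} ∈ κ⁻¹(pⁿℤ_p)` (FILE 6), and FILE 4's `card_le_natCard_quotient_layerIdeal` counts them.
[cite: GreenbergLNM1716, §1 p. 60, §3 pp. 85–86] -/
theorem card_le_natCard_quotient_layerIdeal_mul_natCard_ker_of_restrictTower [W.IsElliptic]
    [Module.Finite (IwasawaAlgebra p) D.X]
    [Finite ((W.baseChange (κ.layer n)).layerToInfty κn 0).ker]
    (s : Finset {z : (W.baseChange (κ.layer n)).selmerInftyPreimage κn 0 // p • z = 0}) :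
    s.card ≤ Nat.card (D.X ⧸ Ideal.span {(C (p : ℤ_[p]) : IwasawaAlgebra p),
        (1 + (X : IwasawaAlgebra p)) ^ p ^ n - 1} • (⊤ : Submodule (IwasawaAlgebra p) D.X)) *
      Nat.card ((W.baseChange (κ.layer n)).layerToInfty κn 0).ker := by
  -- the transport `g z = kerH1Iso (h'_0 z) ∈ Sel_∞`
  let g : {z : (W.baseChange (κ.layer n)).selmerInftyPreimage κn 0 // p • z = 0} →
      W.selmerInfty κ := fun z ↦
    ⟨kerH1Iso W κ n κn hκn ((W.baseChange (κ.layer n)).layerToInfty κn 0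
        (z.1 : (W.baseChange (κ.layer n)).subgroupH1 p (κn.layerSubgroup 0))),
      kerH1Iso_mem_selmerInfty W κ n κn hκn _ z.1.2⟩
  have hg_coe : ∀ z, ((g z : W.selmerInfty κ) : W.subgroupH1 p κ.kerSubgroup) =
      kerH1Iso W κ n κn hκn ((W.baseChange (κ.layer n)).layerToInfty κn 0
        (z.1 : (W.baseChange (κ.layer n)).subgroupH1 p (κn.layerSubgroup 0))) := fun _ ↦ rfl
  -- fibres of `g` embed in `ker h'_0`
  have hg : ∀ z z' : {z : (W.baseChange (κ.layer n)).selmerInftyPreimage κn 0 // p • z = 0},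
      g z = g z' →
      ((z.1 : (W.baseChange (κ.layer n)).subgroupH1 p (κn.layerSubgroup 0)) - z'.1) ∈
        ((W.baseChange (κ.layer n)).layerToInfty κn 0).ker := by
    intro z z' h
    have h' := congrArg (fun s : W.selmerInfty κ ↦ (s : W.subgroupH1 p κ.kerSubgroup)) h
    simp only [hg_coe] at h'
    rw [AddMonoidHom.mem_ker, map_sub, (kerH1Iso W κ n κn hκn).injective h', sub_self]
  have hfib : ∀ b ∈ s.image g, (s.filter fun z ↦ g z = b).card ≤
      Nat.card ((W.baseChange (κ.layer n)).layerToInfty κn 0).ker := by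
    intro b hb
    obtain ⟨z₀, -, rfl⟩ := Finset.mem_image.mp hb
    rw [← Nat.card_eq_finsetCard]
    refine Nat.card_le_card_of_injective
      (fun z : ↥(s.filter fun z ↦ g z = g z₀) ↦
        (⟨(z.1.1 : (W.baseChange (κ.layer n)).subgroupH1 p (κn.layerSubgroup 0)) - z₀.1,
          hg z.1 z₀ (Finset.mem_filter.mp z.2).2⟩ :
          ((W.baseChange (κ.layer n)).layerToInfty κn 0).ker)) fun z z' h ↦ ?_
    have h1 : ((z.1.1 : (W.baseChange (κ.layer n)).subgroupH1 p (κn.layerSubgroup 0)) - z₀.1) =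
        (z'.1.1 : (W.baseChange (κ.layer n)).subgroupH1 p (κn.layerSubgroup 0)) - z₀.1 :=
      congrArg Subtype.val h
    exact Subtype.ext (Subtype.ext (Subtype.ext (sub_left_injective h1)))
  -- the images are `p`-torsion and `γ^{pⁿ}`-fixed
  have himg : ∀ t ∈ s.image g, p • t = 0 ∧
      W.conjH1 p κ.kerSubgroup (γ ^ p ^ n) (t : W.subgroupH1 p κ.kerSubgroup) = t := by
    intro t ht
    obtain ⟨z, -, rfl⟩ := Finset.mem_image.mp ht
    refine ⟨?_, ?_⟩
    · apply Subtype.ext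
      have hz : ((p • z.1 : (W.baseChange (κ.layer n)).selmerInftyPreimage κn 0) :
          (W.baseChange (κ.layer n)).subgroupH1 p (κn.layerSubgroup 0)) = 0 := by
        rw [z.2]; rfl
      change p • kerH1Iso W κ n κn hκn ((W.baseChange (κ.layer n)).layerToInfty κn 0
        (z.1 : (W.baseChange (κ.layer n)).subgroupH1 p (κn.layerSubgroup 0))) = 0
      rw [← map_nsmul, ← map_nsmul, ← AddSubgroup.coe_nsmul, hz, map_zero, map_zero]
    · exact GeneratorCountLayerTransport.conjH1_kerH1Iso_layerToInfty_eq W κ n κn hκn _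
        (pow_mem_layerSubgroup κ γ n)
  calc s.card ≤ Nat.card ((W.baseChange (κ.layer n)).layerToInfty κn 0).ker * (s.image g).card :=
        Finset.card_le_mul_card_image _ _ hfib
    _ ≤ Nat.card ((W.baseChange (κ.layer n)).layerToInfty κn 0).ker *
          Nat.card (D.X ⧸ Ideal.span {(C (p : ℤ_[p]) : IwasawaAlgebra p),
            (1 + (X : IwasawaAlgebra p)) ^ p ^ n - 1} •
              (⊤ : Submodule (IwasawaAlgebra p) D.X)) :=
        Nat.mul_le_mul_left _ (card_le_natCard_quotient_layerIdeal D n _ himg)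
    _ = _ := mul_comm _ _

/-- **`#s ≤ #(X/I_n X) · #E[p^∞]^{Γ_{K_n}}`** — the kernel of `h'_0` has the order of the
`Γ_{K_n}`-fixed points of `E_{K_n}[p^∞]` (`= E(K_n)[p^∞]`; gen 16
`GeneratorCountTorsion.natCard_ker_layerToInfty_zero_eq` over `K_n`, Greenberg Lemma 3.1) when
`E(K_{n,∞})[p^∞]` is finite. [cite: GreenbergLNM1716, §3 Lemma 3.1 (p. 86), §4 Lemma 4.3] -/
theorem card_le_natCard_quotient_layerIdeal_mul_natCard_fixedPoints_of_restrictTower [W.IsElliptic]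
    [Module.Finite (IwasawaAlgebra p) D.X]
    [Finite (FixedPoints.addSubgroup κn.kerSubgroup
      (geomPrimaryTorsion (W.baseChange (κ.layer n)) p))]
    (s : Finset {z : (W.baseChange (κ.layer n)).selmerInftyPreimage κn 0 // p • z = 0}) :
    s.card ≤ Nat.card (D.X ⧸ Ideal.span {(C (p : ℤ_[p]) : IwasawaAlgebra p),
        (1 + (X : IwasawaAlgebra p)) ^ p ^ n - 1} • (⊤ : Submodule (IwasawaAlgebra p) D.X)) *
      Nat.card {a : geomPrimaryTorsion (W.baseChange (κ.layer n)) p //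
        ∀ σ : Field.absoluteGaloisGroup (κ.layer n), σ • a = a} := by
  haveI : NumberField (κ.layer n) := numberField_layer κ n
  haveI := GeneratorCountTorsion.finite_ker_layerToInfty_zero (W.baseChange (κ.layer n)) κn
  rw [← GeneratorCountTorsion.natCard_ker_layerToInfty_zero_eq (W.baseChange (κ.layer n)) κn]
  exact card_le_natCard_quotient_layerIdeal_mul_natCard_ker_of_restrictTower n κn hκn D s

/-- **… `≤ p^{λ(X) + pⁿμ(X)} · #E[p^∞]^{Γ_{K_n}}`** when `X` is torsion without nonzero finite
`Λ`-submodules (FILE 5 `natCard_quotient_layerIdeal_le_pow`) — route T's layer-`n` count with the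
`δ`-loss, X1R0-GAPMAP §14.1. [cite: GreenbergLNM1716, §3 Lemma 3.1, §4 Lemma 4.3, p. 137] -/
theorem card_le_pow_mul_natCard_fixedPoints_of_restrictTower [W.IsElliptic]
    [Module.Finite (IwasawaAlgebra p) D.X]
    [Finite (FixedPoints.addSubgroup κn.kerSubgroup
      (geomPrimaryTorsion (W.baseChange (κ.layer n)) p))]
    (hX : D.IsTorsion) (hnf : ∀ N : Submodule (IwasawaAlgebra p) D.X, Finite N → N = ⊥)
    (s : Finset {z : (W.baseChange (κ.layer n)).selmerInftyPreimage κn 0 // p • z = 0}) :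
    s.card ≤ p ^ (lambdaInvariant p D.X + p ^ n * muInvariant p D.X) *
      Nat.card {a : geomPrimaryTorsion (W.baseChange (κ.layer n)) p //
        ∀ σ : Field.absoluteGaloisGroup (κ.layer n), σ • a = a} :=
  (card_le_natCard_quotient_layerIdeal_mul_natCard_fixedPoints_of_restrictTower n κn hκn D s).trans
    (Nat.mul_le_mul_right _ (natCard_quotient_layerIdeal_le_pow D.X hX hnf n))

end Summit.BirchSwinnertonDyer.Rank1Residual.X1.GeneratorCountLayerTransportTorsion

end
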